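import Summits.NavierStokesRegularity.NavierStokesRegularity.Theorems.TypeIQuarterGatePerSolutionTFAE
import HarnessLib

/-!
# `TypeIQuarterGate.QuarterLawTypeI` (crux stmt-NavierStokesRegularity-23726) HOLDS on the
# Leray `L^q` class, `0 < q < ∞`: only the endpoint `q = ∞` is open

Helper file (`--supports stmt-NavierStokesRegularity-23726`, def-free). Leray (1934) proved that every
blow-up at `T` obeys the LOWER bounds `‖u(s)‖_{L^q} ≥ c_q ν^{(q+3)/(2q)−1}(T−s)^{(3−q)/(2q)}` for
`3 < q ≤ ∞` and `∫‖∇u(s)‖² ≥ c ν^{3/2}(T−s)^{−1/2}`. The sup-norm Type-I rate `IsTypeIBlowup` is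
SATURATION of Leray's rate at `q = ∞`; the conclusion of the crux `QuarterLawTypeI`
(`∫‖curl u(t)‖² ≤ K/√(T−t)`) is saturation of Leray's enstrophy rate. This file records that
saturation at ANY FINITE exponent already gives the quarter law:

* `volumeSparse_of_weakLqRate` (pure measure theory, Chebyshev at one level): if
  `sup_λ λ^q |{λ < ‖u(s)‖}| ≤ A (T−s)^{(3−q)/2}` on `[0,T)` for some real `q > 0` (the weak-`L^q`
  form of Leray's rate), then the near-top super-level set `{c₀√(ν/(T−s)) < ‖u(s)‖}` has volume
  `≤ N (ν(T−s))^{3/2}` — ONE-LEVEL VOLUME SPARSENESS, item 3 of `LorentzOfEnvelope.typeI_slice_tfae`.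
* `quarterLaw_of_weakLqRate`, `lorentzBound_of_weakLqRate`, `count_of_weakLqRate`: along a maximal
  classical Leray–Hopf solution from a rapidly decaying datum with the sup-norm Type-I rate, the
  weak-`L^q` Leray rate for ONE `q ∈ (0,∞)` gives the quarter law, the uniform weak-`L³` bound
  (the conclusion of `LorentzUpgradeTypeI`, stmt-24108 = the registered open stub `stub_lorentzUpgrade`)
  and the scale-uniform ε-concentration count (stmt-23970) — by the landed Lamb-slaving equivalence
  `EnstrophyQuarterLaw.LambBudget.sliceLaw_iff_typeI_and_volumeSparse` / `typeI_slice_tfae`.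
* `quarterLaw_of_lerayLqRate`: the same from the strong form `‖u(s)‖_{L^q} ≤ M (T−s)^{(3−q)/(2q)}`
  (Chebyshev `eWeakLpPow_le_eLpNorm_rpow`), and the BY-NAME localisation
  `quarterLawTypeI_on_lerayLqClass`: the crux `QuarterLawTypeI` with the extra hypothesis
  «`u` saturates Leray's `L^q` rate for some finite `q`».

READING (literature pin). Wang–Zhang (J. Anal. Math. 123 (2014), Thm 5.3) prove finitely many singular
points under `‖u‖_{L^{q,∞}_t L^p_x} ≤ M`, `3/p + 2/q = 1`, `3 < p < ∞`, and state that the endpoint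
`p = ∞` (the sup-norm Type-I rate) is not covered; Choe–Wolf–Yang (Math. Ann. 2019, Thm 2) and
Barker (PAMS B 2024) need `L^∞_t L^{3,∞}_x`. The present file is the tree-internal form of that range
statement for THIS crux: every finite-`q` Leray class is settled by Chebyshev + Lamb slaving, and the
crux `QuarterLawTypeI` ≡ `LorentzUpgradeTypeI` ≡ `UniformConcentrationCountTypeI` is EXACTLY its
`q = ∞` endpoint.

HONEST FRAMING: a sufficient condition for three OPEN, coincident statements about a HYPOTHETICAL
Type-I blow-up; no stub is closed, the class may well be empty, and nothing about Navier–Stokes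
regularity or blow-up is claimed. [cite: Leray1934, §21 (3.15)–(3.16)] [folklore]
-/

-- the problem directory repeats the summit name (`NavierStokesRegularity/NavierStokesRegularity`)
set_option linter.dupNamespace false

noncomputable section

open Set Filter MeasureTheory Topology Metric
open scoped ENNReal NNReal

namespace Summit.NavierStokesRegularity.NavierStokesRegularity.Theorems

namespace LerayLqClass

open Literature.Analysis.FluidPDE Literature.Analysis.FunctionSpaces

variable {ν T : ℝ} {u : ℝ → EuclideanSpace ℝ (Fin 3) → EuclideanSpace ℝ (Fin 3)}
  {p : ℝ → EuclideanSpace ℝ (Fin 3) → ℝ}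

/-! ### 1. Chebyshev at the near-top level (no Navier–Stokes input) -/

/-- Power bookkeeping behind the Chebyshev step: with `τ = T − s > 0`, `λ = c₀√(ν/τ)` and
`N = A / ((c₀√ν)^q (√ν)^3)`, one has `A τ^{(3−q)/2} = λ^q · N · (√(ντ))^3`. [folklore] -/
theorem level_pow_identity {c₀ ν τ q A : ℝ} (hc₀ : 0 < c₀) (hν : 0 < ν) (hτ : 0 < τ) :
    A * τ ^ ((3 - q) / 2) =
      (c₀ * Real.sqrt (ν / τ)) ^ q * (A / ((c₀ * Real.sqrt ν) ^ q * Real.sqrt ν ^ 3) *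
        Real.sqrt (ν * τ) ^ 3) := by
  have hsν : 0 < Real.sqrt ν := Real.sqrt_pos.2 hν
  have hsτ : 0 < Real.sqrt τ := Real.sqrt_pos.2 hτ
  have hcν : 0 < c₀ * Real.sqrt ν := mul_pos hc₀ hsν
  -- `λ = (c₀√ν)/√τ`, `√(ντ) = √ν √τ`
  have hlam : c₀ * Real.sqrt (ν / τ) = c₀ * Real.sqrt ν / Real.sqrt τ := by
    rw [Real.sqrt_div hν.le, mul_div_assoc]
  have hprod : Real.sqrt (ν * τ) = Real.sqrt ν * Real.sqrt τ := Real.sqrt_mul hν.le τ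
  -- `τ^{(3−q)/2} = (√τ)^3 / (√τ)^q`
  have hτpow : τ ^ ((3 - q) / 2) = Real.sqrt τ ^ 3 / Real.sqrt τ ^ q := by
    have h1 : τ = Real.sqrt τ ^ (2 : ℝ) := by
      rw [Real.rpow_two, Real.sq_sqrt hτ.le]
    rw [h1, ← Real.rpow_mul hsτ.le, show (2 : ℝ) * ((3 - q) / 2) = 3 - q by ring,
      Real.rpow_sub hsτ, Real.rpow_two, Real.sq_sqrt hτ.le]
    norm_cast
  rw [hlam, Real.div_rpow hcν.le hsτ.le, hprod, hτpow, mul_pow]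
  have h1 : (c₀ * Real.sqrt ν) ^ q ≠ 0 := (Real.rpow_pos_of_pos hcν q).ne'
  have h2 : Real.sqrt τ ^ q ≠ 0 := (Real.rpow_pos_of_pos hsτ q).ne'
  have h3 : Real.sqrt ν ^ 3 ≠ 0 := pow_ne_zero 3 hsν.ne'
  field_simp

/-- **Chebyshev at one level: a weak-`L^q` self-similar rate gives one-level volume sparseness.**
If `eWeakLpPow (u s) q = sup_λ λ^q |{λ < ‖u(s)‖}| ≤ A (T−s)^{(3−q)/2}` for all `s ∈ [0,T)` (some real
`q > 0`; the weak form of Leray's rate `‖u(s)‖_{L^q} ≤ M(T−s)^{(3−q)/(2q)}`), then for every `c₀ > 0`,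
`ν > 0` there is `N` with `|{c₀√(ν/(T−s)) < ‖u(s)‖}| ≤ N (√(ν(T−s)))³` on `[0,T)`. Pure measure
theory: no equation is used. [folklore] -/
theorem volumeSparse_of_weakLqRate {c₀ : ℝ} (hc₀ : 0 < c₀) (hν : 0 < ν) {q : ℝ} (hq : 0 < q)
    {A : ℝ}
    (hA : ∀ s ∈ Ico 0 T, eWeakLpPow (u s) (ENNReal.ofReal q) volume ≤
      ENNReal.ofReal (A * (T - s) ^ ((3 - q) / 2))) :
    ∃ N : ℝ, ∀ s ∈ Ico 0 T,
      volume {x : EuclideanSpace ℝ (Fin 3) | c₀ * Real.sqrt (ν / (T - s)) < ‖u s x‖} ≤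
        ENNReal.ofReal (N * Real.sqrt (ν * (T - s)) ^ 3) := by
  set A' : ℝ := max A 0 with hA'
  refine ⟨A' / ((c₀ * Real.sqrt ν) ^ q * Real.sqrt ν ^ 3), fun s hs => ?_⟩
  have hτ : 0 < T - s := sub_pos.2 hs.2
  have hlam : 0 < c₀ * Real.sqrt (ν / (T - s)) := mul_pos hc₀ (Real.sqrt_pos.2 (div_pos hν hτ))
  -- Chebyshev at the level `λ = c₀√(ν/(T−s))`
  have hcheb := ofReal_rpow_mul_meas_lt_le_eWeakLpPow (u s) (ENNReal.ofReal q) volume hlam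
  rw [ENNReal.toReal_ofReal hq.le] at hcheb
  have hA1 : ENNReal.ofReal (A * (T - s) ^ ((3 - q) / 2)) ≤
      ENNReal.ofReal (A' * (T - s) ^ ((3 - q) / 2)) :=
    ENNReal.ofReal_le_ofReal
      (mul_le_mul_of_nonneg_right (le_max_left A 0) (Real.rpow_nonneg hτ.le _))
  have hmain := (hcheb.trans (hA s hs)).trans hA1
  rw [level_pow_identity (q := q) (A := A') hc₀ hν hτ,
    ENNReal.ofReal_mul (Real.rpow_nonneg hlam.le q)] at hmain
  have h0 : ENNReal.ofReal ((c₀ * Real.sqrt (ν / (T - s))) ^ q) ≠ 0 :=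
    (ENNReal.ofReal_pos.2 (Real.rpow_pos_of_pos hlam q)).ne'
  exact (ENNReal.mul_le_mul_iff_right h0 ENNReal.ofReal_ne_top).1 hmain

/-- The strong form implies the weak form: `‖u(s)‖_{L^q} ≤ M (T−s)^{(3−q)/(2q)}` with `q > 0` and
measurable slices gives `eWeakLpPow (u s) q ≤ (max M 0)^q (T−s)^{(3−q)/2}` (Chebyshev,
`eWeakLpPow_le_eLpNorm_rpow`). [folklore] -/
theorem weakLqRate_of_lerayLqRate {q : ℝ} (hq : 0 < q) {M : ℝ}
    (hmeas : ∀ s ∈ Ico 0 T, AEStronglyMeasurable (u s) volume)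
    (hM : ∀ s ∈ Ico 0 T, eLpNorm (u s) (ENNReal.ofReal q) volume ≤
      ENNReal.ofReal (M * (T - s) ^ ((3 - q) / (2 * q)))) :
    ∀ s ∈ Ico 0 T, eWeakLpPow (u s) (ENNReal.ofReal q) volume ≤
      ENNReal.ofReal ((max M 0) ^ q * (T - s) ^ ((3 - q) / 2)) := by
  intro s hs
  have hτ : 0 < T - s := sub_pos.2 hs.2
  have hq0 : ENNReal.ofReal q ≠ 0 := (ENNReal.ofReal_pos.2 hq).ne'
  have h1 := eWeakLpPow_le_eLpNorm_rpow hq0 ENNReal.ofReal_ne_top (hmeas s hs)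
  rw [ENNReal.toReal_ofReal hq.le] at h1
  refine h1.trans ?_
  have hM' : eLpNorm (u s) (ENNReal.ofReal q) volume ≤
      ENNReal.ofReal (max M 0 * (T - s) ^ ((3 - q) / (2 * q))) :=
    (hM s hs).trans (ENNReal.ofReal_le_ofReal
      (mul_le_mul_of_nonneg_right (le_max_left M 0) (Real.rpow_nonneg hτ.le _)))
  have hnn : 0 ≤ max M 0 * (T - s) ^ ((3 - q) / (2 * q)) :=
    mul_nonneg (le_max_right M 0) (Real.rpow_nonneg hτ.le _)
  calc eLpNorm (u s) (ENNReal.ofReal q) volume ^ q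
      ≤ ENNReal.ofReal (max M 0 * (T - s) ^ ((3 - q) / (2 * q))) ^ q :=
        ENNReal.rpow_le_rpow hM' hq.le
    _ = ENNReal.ofReal ((max M 0) ^ q * (T - s) ^ ((3 - q) / 2)) := by
        rw [ENNReal.ofReal_rpow_of_nonneg hnn hq.le, Real.mul_rpow (le_max_right M 0)
          (Real.rpow_nonneg hτ.le _), ← Real.rpow_mul hτ.le]
        congr 3
        field_simp

/-! ### 2. Along a Type-I blow-up: the Leray `L^q` class obeys the quarter law -/

/-- **Weak-`L^q` Leray rate ⟹ the quarter law** along one maximal classical Leray–Hopf solution from a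
rapidly decaying datum with the sup-norm Type-I rate at `T` (`ν, T > 0`): if for ONE real `q > 0`
`sup_λ λ^q |{λ < ‖u(s)‖}| ≤ A (T−s)^{(3−q)/2}` on `[0,T)`, then `∫‖curl u(t)‖² ≤ K/√(T−t)` on `[0,T)`.
Chebyshev at the level `½√(ν/(T−s))` + Lamb slaving
(`EnstrophyQuarterLaw.LambBudget.sliceLaw_iff_typeI_and_volumeSparse`). [folklore] -/
theorem quarterLaw_of_weakLqRate (hν : 0 < ν) (hT : 0 < T)
    (hmax : IsMaximalSmoothSolution ν 0 u p T) (hLH : IsLerayHopfOn T ν 0 (u 0) u)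
    (hdec : HasRapidSpatialDecay (u 0)) (hI : IsTypeIBlowup u T) {q : ℝ} (hq : 0 < q) {A : ℝ}
    (hA : ∀ s ∈ Ico 0 T, eWeakLpPow (u s) (ENNReal.ofReal q) volume ≤
      ENNReal.ofReal (A * (T - s) ^ ((3 - q) / 2))) :
    ∃ K : ℝ, ∀ t ∈ Ico 0 T,
      ∫⁻ x, ‖curl (u t) x‖ₑ ^ 2 ≤ ENNReal.ofReal (K / Real.sqrt (T - t)) :=
  (EnstrophyQuarterLaw.LambBudget.sliceLaw_iff_typeI_and_volumeSparse (c₀ := 1 / 2)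
      (by norm_num) (by norm_num) hν hT hmax hLH hdec).2
    ⟨hI, volumeSparse_of_weakLqRate (c₀ := 1 / 2) (by norm_num) hν hq hA⟩

/-- **Weak-`L^q` Leray rate ⟹ the uniform weak-`L³` bound** (the conclusion of `LorentzUpgradeTypeI`,
stmt-24108, the registered open stub `stub_lorentzUpgrade` of the line `lorentz-upgrade`) along one
Type-I blow-up: for ONE real `q > 0`, `sup_λ λ^q|{λ<‖u(s)‖}| ≤ A(T−s)^{(3−q)/2}` on `[0,T)` gives
`sup_{[0,T)} sup_λ λ³|{λ<‖u(t)‖}| < ∞`. For `q = 3` the hypothesis IS the conclusion; the content is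
`q ≠ 3`, in particular every `q > 3` short of the open endpoint `q = ∞`. [folklore] -/
theorem lorentzBound_of_weakLqRate (hν : 0 < ν) (hT : 0 < T)
    (hmax : IsMaximalSmoothSolution ν 0 u p T) (hLH : IsLerayHopfOn T ν 0 (u 0) u)
    (hdec : HasRapidSpatialDecay (u 0)) (hI : IsTypeIBlowup u T) {q : ℝ} (hq : 0 < q) {A : ℝ}
    (hA : ∀ s ∈ Ico 0 T, eWeakLpPow (u s) (ENNReal.ofReal q) volume ≤
      ENNReal.ofReal (A * (T - s) ^ ((3 - q) / 2))) :
    ∃ M' : ℝ, ∀ t ∈ Ico 0 T, eWeakLpPow (u t) 3 volume ≤ ENNReal.ofReal M' :=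
  (LorentzOfEnvelope.volumeSparse_iff_weakL3_of_typeI (c₀ := 1 / 2) (by norm_num) (by norm_num)
      hν hT hmax hLH hdec hI).1
    (volumeSparse_of_weakLqRate (c₀ := 1 / 2) (by norm_num) hν hq hA)

/-- **Weak-`L^q` Leray rate ⟹ the scale-uniform ε-concentration count** (the conclusion of
`UniformConcentrationCountTypeI`, stmt-23970) along one Type-I blow-up. [folklore] -/
theorem count_of_weakLqRate (hν : 0 < ν) (hT : 0 < T)
    (hmax : IsMaximalSmoothSolution ν 0 u p T) (hLH : IsLerayHopfOn T ν 0 (u 0) u)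
    (hdec : HasRapidSpatialDecay (u 0)) (hI : IsTypeIBlowup u T) {q : ℝ} (hq : 0 < q) {A : ℝ}
    (hA : ∀ s ∈ Ico 0 T, eWeakLpPow (u s) (ENNReal.ofReal q) volume ≤
      ENNReal.ofReal (A * (T - s) ^ ((3 - q) / 2))) :
    ∀ η : ℝ, 0 < η → ∃ N : ℕ, ∃ r₀ : ℝ, 0 < r₀ ∧ ∀ r : ℝ, 0 < r → r ≤ r₀ →
      ∀ σ : Finset (EuclideanSpace ℝ (Fin 3)),
        (∀ x ∈ σ, ∀ x' ∈ σ, x ≠ x' → 2 * r ≤ ‖x - x'‖) →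
        (∀ x ∈ σ, ENNReal.ofReal (η * r) ≤ ∫⁻ s in Ioo (T - r ^ 2) T, ∫⁻ y in ball x r,
          ENNReal.ofReal (frobeniusNormSq (fderiv ℝ (u s) y))) → σ.card ≤ N :=
  ((LorentzOfEnvelope.typeI_slice_tfae (c₀ := 1 / 2) (by norm_num) (by norm_num) hν hT hmax hLH
      hdec hI).out 2 3).1
    (volumeSparse_of_weakLqRate (c₀ := 1 / 2) (by norm_num) hν hq hA)

/-- **Leray's strong `L^q` rate ⟹ the quarter law** along one Type-I blow-up: if for ONE real `q > 0`
the slices obey `‖u(s)‖_{L^q} ≤ M (T−s)^{(3−q)/(2q)}` on `[0,T)` (SATURATION of Leray's 1934 lower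
bound when `q > 3`), then `∫‖curl u(t)‖² ≤ K/√(T−t)` on `[0,T)`. [cite: Leray1934, §21 (3.15)–(3.16)] -/
theorem quarterLaw_of_lerayLqRate (hν : 0 < ν) (hT : 0 < T)
    (hmax : IsMaximalSmoothSolution ν 0 u p T) (hLH : IsLerayHopfOn T ν 0 (u 0) u)
    (hdec : HasRapidSpatialDecay (u 0)) (hI : IsTypeIBlowup u T) {q : ℝ} (hq : 0 < q) {M : ℝ}
    (hM : ∀ s ∈ Ico 0 T, eLpNorm (u s) (ENNReal.ofReal q) volume ≤
      ENNReal.ofReal (M * (T - s) ^ ((3 - q) / (2 * q)))) :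
    ∃ K : ℝ, ∀ t ∈ Ico 0 T,
      ∫⁻ x, ‖curl (u t) x‖ₑ ^ 2 ≤ ENNReal.ofReal (K / Real.sqrt (T - t)) :=
  quarterLaw_of_weakLqRate hν hT hmax hLH hdec hI hq
    (weakLqRate_of_lerayLqRate hq
      (fun _s hs => ((hmax.1.contDiff_velocity hs).continuous).aestronglyMeasurable) hM)

/-! ### 3. By name: the crux on the Leray `L^q` class -/

/-- **`QuarterLawTypeI` (stmt-NavierStokesRegularity-23726) ON THE LERAY `L^q` CLASS, by name.** The
crux's hypotheses plus «for some finite `q > 0` the slices saturate Leray's `L^q` rate,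
`‖u(s)‖_{L^q} ≤ M (T−s)^{(3−q)/(2q)}` on `[0,T)`» give the crux's conclusion. The crux itself is the
endpoint `q = ∞` of this family (its hypothesis `IsTypeIBlowup` is saturation of Leray's `L^∞` rate),
which this file does NOT touch. [cite: Leray1934, §21 (3.15)–(3.16)] -/
theorem quarterLawTypeI_on_lerayLqClass :
    ∀ (ν T : ℝ), 0 < ν → 0 < T → ∀ (u : ℝ → EuclideanSpace ℝ (Fin 3) → EuclideanSpace ℝ (Fin 3))
      (p : ℝ → EuclideanSpace ℝ (Fin 3) → ℝ),
      IsMaximalSmoothSolution ν 0 u p T → IsLerayHopfOn T ν 0 (u 0) u →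
      HasRapidSpatialDecay (u 0) → IsTypeIBlowup u T →
      (∃ q M : ℝ, 0 < q ∧ ∀ s ∈ Ico 0 T, eLpNorm (u s) (ENNReal.ofReal q) volume ≤
        ENNReal.ofReal (M * (T - s) ^ ((3 - q) / (2 * q)))) →
      ∃ K : ℝ, ∀ t ∈ Ico 0 T,
        ∫⁻ x, ‖curl (u t) x‖ₑ ^ 2 ≤ ENNReal.ofReal (K / Real.sqrt (T - t)) :=
  fun _ν _T hν hT _u _p hmax hLH hdec hI ⟨_q, _M, hq, hM⟩ =>
    quarterLaw_of_lerayLqRate hν hT hmax hLH hdec hI hq hM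

/-- **`LorentzUpgradeTypeI` (stmt-24108, the open stub `stub_lorentzUpgrade`) ON THE LERAY weak-`L^q`
CLASS, by name**: the stub's hypotheses plus a weak-`L^q` Leray rate for some finite `q > 0` give its
conclusion (uniform weak-`L³` bound). [folklore] -/
theorem lorentzUpgradeTypeI_on_weakLqClass :
    ∀ (ν T : ℝ), 0 < ν → 0 < T → ∀ (u : ℝ → EuclideanSpace ℝ (Fin 3) → EuclideanSpace ℝ (Fin 3))
      (p : ℝ → EuclideanSpace ℝ (Fin 3) → ℝ),
      IsMaximalSmoothSolution ν 0 u p T → IsLerayHopfOn T ν 0 (u 0) u →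
      HasRapidSpatialDecay (u 0) → IsTypeIBlowup u T →
      (∃ q A : ℝ, 0 < q ∧ ∀ s ∈ Ico 0 T, eWeakLpPow (u s) (ENNReal.ofReal q) volume ≤
        ENNReal.ofReal (A * (T - s) ^ ((3 - q) / 2))) →
      ∃ M' : ℝ, ∀ t ∈ Ico 0 T, eWeakLpPow (u t) 3 volume ≤ ENNReal.ofReal M' :=
  fun _ν _T hν hT _u _p hmax hLH hdec hI ⟨_q, _A, hq, hA⟩ =>
    lorentzBound_of_weakLqRate hν hT hmax hLH hdec hI hq hA

end LerayLqClass

end Summit.NavierStokesRegularity.NavierStokesRegularity.Theorems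

end
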